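import Summits.Parity.GeneralizedHardyLittlewood.Theorems.PrimeLevelFamEdgeMomentsBeyondDiagonalDiagCornerAbelBVTwoVar
import Summits.Parity.GeneralizedHardyLittlewood.Theorems.PrimeLevelFamEdgeMomentsBeyondDiagonalDiagCornerAbelRayLog
import HarnessLib

/-!
# Route `PrimeLevelFamEdge`, crux K_A `MomentsBeyondDiagonal` (stmt-Parity-20007), line «petersson_layers» v4, stub `stub_diag`:
# **the two-variable Abel estimate with TWO DIFFERENT coefficient sequences** (remainder estimate (R) of order `(1,1)`)

`…DiagCornerAbelBVTwoVar.abs_doubleSum_bv_pow_le` (p820228) and `…DiagCornerAbelFinal.abs_doubleSum_sqrt_log_weight_le`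
bound `Σ_{k₁,k₂≤Y} a(k₁)a(k₂)ℓ⁺(k₁)ⁱℓ⁺(k₂)ʲ r(αk₁k₂)` for ONE sequence `a`. The Hecke-summed remainder weight of order `(1,1)`
(hypothesis (R) of `…DiagDecorOrderOneOneAssembly.orderOneOne_target_of_remainder`, p826053) carries the decoration
`P₂(k) = Σ_{p∣k} log²p` on one variable, whose twisted partial sums `Σ_{k≤e} a_n(k)P₂(k)` are bounded but do NOT tend to zero.
Inspection of the two-regime argument shows that only the ROW variable `k₁` needs the small tail `η` of its partial sums,
while the COLUMN variable `k₂` needs only a uniform bound `B` for `e ≤ Y`; so the decoration can always be put on `k₂`: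

* `abs_doubleSum_bv_pow_le₂` — **`|Σ_{k₁,k₂≤Y} a₁(k₁)a₂(k₂)ℓ⁺(k₁)ⁱℓ⁺(k₂)ʲ r(αk₁k₂)| ≤ Sᵢ(a₁)·B₂·logʲY·(H₁+V₁) +
  Sⱼ(a₂)·2η₁·logⁱY·(G+V)`** (`|Σ_{k≤e}a₂| ≤ B₂` for `e ≤ ⌊Y⌋` only; `|Σ_{k≤e}a₁| ≤ η₁` for `e ≥ K₁`);
* `abs_doubleSum_sqrt_log_weight_le₂` — the same for a `√`/`log`-controlled weight (constants as in `…CornerAbelFinal`).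

Def-free; theorems only. Helper `--supports stmt-Parity-20007`; closes nothing; K_A, K_B and the Parity summit are NOT
proved; nothing about Landau–Siegel zeros.

## References
* E. Kowalski, P. Michel, J. VanderKam, J. reine angew. Math. 526 (2000), Prop. 5.1 p. 18.
  [cite: KowalskiMichelVanderKam2000, Prop. 5.1 — derivation (corner of the diagonal, general weights, two sequences)]
-/

noncomputable section

open Finset Real

namespace Summit.Parity.GeneralizedHardyLittlewood.Theorems.MomentsBeyondDiagonal.DiagCorner

open Summit.Parity.GeneralizedHardyLittlewood.Theorems.BeyondDiagonalBeatsQuarter.Corner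

/-- **Two-variable Abel estimate for a bounded-variation weight, two coefficient sequences.** Let `a₁, a₂` be real
sequences with `|Σ_{k≤e}a₂(k)| ≤ B` for `e ≤ ⌊Y⌋` and `|Σ_{k≤e}a₁(k)| ≤ η` for `e ≥ K₁`; `Y ≥ 1`, `α > 0`, `i, j ≥ 1`; let
`r : ℝ → ℝ` satisfy `|r(y)| ≤ H₁` (`H₁, V₁ ≥ 0`) for `0 < y ≤ 2αK₁Y`, ray variation `Σ_{0<e≤w}|r(c(e+1)) − r(ce)| ≤ V₁` whenever
`c > 0`, `c(w+1) ≤ 2αK₁Y`, `|r(y)| ≤ G` for `0 < y ≤ 2αY²`, and ray variation `Σ_{u<e≤w}|r(c(e+1)) − r(ce)| ≤ V` whenever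
`c > 0`, `c(w+1) ≤ 2αY²`. Then
`|Σ_{k₁,k₂≤Y} a₁(k₁)a₂(k₂)ℓ⁺(k₁)ⁱℓ⁺(k₂)ʲr(αk₁k₂)| ≤ Sᵢ(a₁)·(B·(logʲY·(H₁+V₁))) + Sⱼ(a₂)·(2η·(logⁱY·(G+V)))`.
[cite: KowalskiMichelVanderKam2000, Prop. 5.1 — derivation (corner of the diagonal, real-variable form, two sequences)] -/
theorem abs_doubleSum_bv_pow_le₂ {a₁ a₂ : ℕ → ℝ} {r : ℝ → ℝ} {Y α B η H₁ V₁ G V : ℝ} {K₁ i j : ℕ}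
    (hY : 1 ≤ Y) (hα : 0 < α) (hi : 1 ≤ i) (hj : 1 ≤ j)
    (hB : ∀ e : ℕ, e ≤ ⌊Y⌋₊ → |∑ k ∈ Icc 1 e, a₂ k| ≤ B) (hη : ∀ e : ℕ, K₁ ≤ e → |∑ k ∈ Icc 1 e, a₁ k| ≤ η)
    (hH₁ : 0 ≤ H₁) (hV₁ : 0 ≤ V₁) (hr1 : ∀ y : ℝ, 0 < y → y ≤ 2 * α * K₁ * Y → |r y| ≤ H₁)
    (hv1 : ∀ c : ℝ, 0 < c → ∀ w : ℕ, c * ((w : ℝ) + 1) ≤ 2 * α * K₁ * Y →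
      ∑ e ∈ Ioc 0 w, |r (c * ((e : ℝ) + 1)) - r (c * e)| ≤ V₁)
    (hrG : ∀ y : ℝ, 0 < y → y ≤ 2 * α * Y ^ 2 → |r y| ≤ G)
    (hvG : ∀ c : ℝ, 0 < c → ∀ u w : ℕ, u ≤ w → c * ((w : ℝ) + 1) ≤ 2 * α * Y ^ 2 →
      ∑ e ∈ Ioc u w, |r (c * ((e : ℝ) + 1)) - r (c * e)| ≤ V) :
    |∑ k₁ ∈ Icc 1 ⌊Y⌋₊, ∑ k₂ ∈ Icc 1 ⌊Y⌋₊,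
        a₁ k₁ * a₂ k₂ * ellp Y k₁ ^ i * ellp Y k₂ ^ j * r (α * k₁ * k₂)| ≤
      (∑ k ∈ Icc 1 ⌊Y⌋₊, |a₁ k| * ellp Y k ^ i) * (B * (Real.log Y ^ j * (H₁ + V₁))) +
        (∑ k ∈ Icc 1 ⌊Y⌋₊, |a₂ k| * ellp Y k ^ j) * ((2 * η) * (Real.log Y ^ i * (G + V))) := by
  have hY0 : 0 < Y := by linarith
  set N : ℕ := ⌊Y⌋₊ with hN
  have hN1 : 1 ≤ N := Nat.le_floor (by simpa using hY)
  have hNY : (N : ℝ) ≤ Y := Nat.floor_le hY0.le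
  have hYN : Y < N + 1 := Nat.lt_floor_add_one Y
  have hN2Y : (N : ℝ) + 1 ≤ 2 * Y := by linarith
  have hLY : 0 ≤ Real.log Y := Real.log_nonneg hY
  have hB0 : 0 ≤ B := (abs_nonneg _).trans (hB 0 (Nat.zero_le _))
  set A : ℕ → ℝ := fun e ↦ ∑ k ∈ Icc 1 e, a₁ k with hAdef
  set Si : ℝ := ∑ k ∈ Icc 1 N, |a₁ k| * ellp Y k ^ i with hSidef
  set Sj : ℝ := ∑ k ∈ Icc 1 N, |a₂ k| * ellp Y k ^ j with hSjdef
  have hell0 : ∀ (m : ℕ) (e : ℕ), 0 ≤ ellp Y e ^ m := fun m e ↦ pow_nonneg (ellp_nonneg Y e) m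
  have hSi0 : 0 ≤ Si := Finset.sum_nonneg fun k _ ↦ mul_nonneg (abs_nonneg _) (hell0 i k)
  have hSj0 : 0 ≤ Sj := Finset.sum_nonneg fun k _ ↦ mul_nonneg (abs_nonneg _) (hell0 j k)
  have hfF : ∀ (m : ℕ) (e : ℕ), ellp Y e ^ m ≤ Real.log Y ^ m := fun m e ↦
    pow_le_pow_left₀ (ellp_nonneg Y e) (ellp_le_log' hY e) m
  have hf : ∀ (m : ℕ) (e : ℕ), 0 < e → ellp Y (e + 1) ^ m ≤ ellp Y e ^ m := fun m e he ↦
    pow_le_pow_left₀ (ellp_nonneg Y _) (ellp_succ_le hY0.le he) m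
  have hfw : ∀ m : ℕ, 1 ≤ m → ellp Y (N + 1) ^ m = 0 := fun m hm ↦ by
    rw [ellp_eq_zero hY0.le le_rfl]; exact zero_pow (by omega)
  -- nonnegativity of the weight constants (from the hypotheses at admissible points)
  have hsmall : 0 < 2 * α * Y ^ 2 := by positivity
  have hG0 : 0 ≤ G := (abs_nonneg _).trans (hrG (2 * α * Y ^ 2) hsmall le_rfl)
  have hV0 : 0 ≤ V := by
    have h := hvG (2 * α * Y ^ 2) hsmall 0 0 le_rfl (by simp)
    simpa using h
  -- ray variation in the cast form used by the Abel lemma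
  have hray : ∀ (c : ℝ) (u w : ℕ), (∑ e ∈ Ioc u w, |r (c * ((e + 1 : ℕ) : ℝ)) - r (c * (e : ℕ))|) =
      ∑ e ∈ Ioc u w, |r (c * ((e : ℝ) + 1)) - r (c * e)| := by
    intro c u w
    refine Finset.sum_congr rfl fun e _ ↦ ?_
    push_cast; ring_nf
  -- split the outer sum at K' = min K₁ N
  set K' : ℕ := min K₁ N with hK'
  have hK'N : K' ≤ N := min_le_right _ _
  have hsplit : ∑ k₁ ∈ Icc 1 N, ∑ k₂ ∈ Icc 1 N,
      a₁ k₁ * a₂ k₂ * ellp Y k₁ ^ i * ellp Y k₂ ^ j * r (α * k₁ * k₂) =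
      ∑ k₁ ∈ Icc 1 K', a₁ k₁ * ellp Y k₁ ^ i *
          ∑ k₂ ∈ Ioc 0 N, a₂ k₂ * (ellp Y k₂ ^ j * r (α * k₁ * k₂)) +
        ∑ k₂ ∈ Icc 1 N, a₂ k₂ * ellp Y k₂ ^ j *
          ∑ k₁ ∈ Ioc K' N, a₁ k₁ * (ellp Y k₁ ^ i * r (α * k₂ * k₁)) := by
    have hIcc : Icc 1 N = Icc 1 K' ∪ Ioc K' N := by
      ext k; simp only [Finset.mem_union, Finset.mem_Icc, Finset.mem_Ioc]; omega
    have hdisj : Disjoint (Icc 1 K') (Ioc K' N) := by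
      rw [Finset.disjoint_left]; intro k hk hk'
      simp only [Finset.mem_Icc, Finset.mem_Ioc] at hk hk'; omega
    conv_lhs => arg 1; rw [hIcc]
    rw [Finset.sum_union hdisj]
    congr 1
    · refine Finset.sum_congr rfl fun k₁ _ ↦ ?_
      rw [Finset.mul_sum, ← Literature.Barriers.Parity.Icc_one_eq_Ioc_zero]
      exact Finset.sum_congr rfl fun k₂ _ ↦ by ring
    · rw [Finset.sum_comm]
      refine Finset.sum_congr rfl fun k₂ _ ↦ ?_
      rw [Finset.mul_sum]
      refine Finset.sum_congr rfl fun k₁ _ ↦ ?_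
      rw [show α * (k₂ : ℝ) * k₁ = α * k₁ * k₂ by ring]
      ring
  rw [hsplit]
  -- Part 1: rows k₁ ≤ K' (partial sums of `a₂`, uniform bound `B`)
  have hpart1 : ∀ k₁ ∈ Icc 1 K',
      |∑ k₂ ∈ Ioc 0 N, a₂ k₂ * (ellp Y k₂ ^ j * r (α * k₁ * k₂))| ≤ B * (Real.log Y ^ j * (H₁ + V₁)) := by
    intro k₁ hk₁
    have hk₁' := Finset.mem_Icc.1 hk₁
    have hk₁0 : (0 : ℝ) < k₁ := by exact_mod_cast hk₁'.1
    have hk₁K : (k₁ : ℝ) ≤ K₁ := by exact_mod_cast hk₁'.2.trans (min_le_left _ _)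
    have hc : 0 < α * k₁ := by positivity
    have hcN : α * k₁ * ((N : ℝ) + 1) ≤ 2 * α * K₁ * Y := by
      calc α * k₁ * ((N : ℝ) + 1) ≤ α * K₁ * (2 * Y) := by gcongr
        _ = 2 * α * K₁ * Y := by ring
    have hH : ∀ e : ℕ, 0 < e → e ≤ N + 1 → |r (α * k₁ * e)| ≤ H₁ := by
      intro e he heN
      refine hr1 _ (by positivity) ?_
      have : (e : ℝ) ≤ N + 1 := by exact_mod_cast heN
      calc α * k₁ * e ≤ α * k₁ * ((N : ℝ) + 1) := by gcongr
        _ ≤ 2 * α * K₁ * Y := hcN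
    have hVV : ∑ e ∈ Ioc 0 N, |r (α * k₁ * ((e + 1 : ℕ) : ℝ)) - r (α * k₁ * (e : ℕ))| ≤ V₁ := by
      rw [hray]; exact hv1 (α * k₁) hc N hcN
    exact abs_sum_Ioc_mul_prod_le_of_bv a₂ (Nat.zero_le N) (B := B) (F := Real.log Y ^ j) (H := H₁) (V := V₁)
      (f := fun e ↦ ellp Y e ^ j) (h := fun e ↦ r (α * k₁ * e))
      hB0 (fun e _ heN ↦ by
        rw [Finset.Icc_eq_empty (show ¬ (1 : ℕ) ≤ 0 by norm_num), Finset.sum_empty, sub_zero]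
        exact hB e heN)
      (hell0 j) (hfF j) (fun e he ↦ hf j e he) (hfw j hj)
      (fun e he heN ↦ hH e he heN) hVV
  -- Part 2: columns, Abel in k₁ over (K', N] (partial sums of `a₁`, tail bound `η`)
  have hη0 : 0 ≤ η := (abs_nonneg _).trans (hη K₁ le_rfl)
  have hpart2 : ∀ k₂ ∈ Icc 1 N,
      |∑ k₁ ∈ Ioc K' N, a₁ k₁ * (ellp Y k₁ ^ i * r (α * k₂ * k₁))| ≤ (2 * η) * (Real.log Y ^ i * (G + V)) := by
    intro k₂ hk₂
    have hk₂' := Finset.mem_Icc.1 hk₂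
    have hk₂0 : (0 : ℝ) < k₂ := by exact_mod_cast hk₂'.1
    have hk₂N : (k₂ : ℝ) ≤ N := by exact_mod_cast hk₂'.2
    have hc : 0 < α * k₂ := by positivity
    rcases eq_or_lt_of_le hK'N with hKN | hKN
    · rw [hKN]; simp only [Finset.Ioc_self, Finset.sum_empty, abs_zero]
      positivity
    have hK'K : K' = K₁ := by omega
    have hη2 : ∀ e, K' < e → e ≤ N → |A e - A K'| ≤ 2 * η := by
      intro e he _
      rw [hK'K] at he ⊢
      calc |A e - A K₁| ≤ |A e| + |A K₁| := abs_sub _ _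
        _ ≤ η + η := add_le_add (hη e he.le) (hη K₁ le_rfl)
        _ = 2 * η := by ring
    have hcN : α * k₂ * ((N : ℝ) + 1) ≤ 2 * α * Y ^ 2 := by
      calc α * k₂ * ((N : ℝ) + 1) ≤ α * Y * (2 * Y) := by gcongr; exact hk₂N.trans hNY
        _ = 2 * α * Y ^ 2 := by ring
    have hH : ∀ e : ℕ, 0 < e → e ≤ N + 1 → |r (α * k₂ * e)| ≤ G := by
      intro e he heN
      refine hrG _ (by positivity) ?_
      have : (e : ℝ) ≤ N + 1 := by exact_mod_cast heN
      calc α * k₂ * e ≤ α * k₂ * ((N : ℝ) + 1) := by gcongr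
        _ ≤ 2 * α * Y ^ 2 := hcN
    have hVV : ∑ e ∈ Ioc K' N, |r (α * k₂ * ((e + 1 : ℕ) : ℝ)) - r (α * k₂ * (e : ℕ))| ≤ V := by
      rw [hray]; exact hvG (α * k₂) hc K' N hK'N hcN
    exact abs_sum_Ioc_mul_prod_le_of_bv a₁ hK'N (B := 2 * η) (F := Real.log Y ^ i) (H := G) (V := V)
      (f := fun e ↦ ellp Y e ^ i) (h := fun e ↦ r (α * k₂ * e))
      (by positivity) (fun e he heN ↦ hη2 e he heN) (hell0 i) (hfF i) (fun e he ↦ hf i e (by omega))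
      (hfw i hi) (fun e he heN ↦ hH e (by omega) heN) hVV
  -- assemble
  have hS' : ∑ k ∈ Icc 1 K', |a₁ k| * ellp Y k ^ i ≤ Si := by
    rw [hSidef]
    exact Finset.sum_le_sum_of_subset_of_nonneg (Finset.Icc_subset_Icc_right hK'N)
      (fun k _ _ ↦ mul_nonneg (abs_nonneg _) (hell0 i k))
  have h1 : |∑ k₁ ∈ Icc 1 K', a₁ k₁ * ellp Y k₁ ^ i *
      ∑ k₂ ∈ Ioc 0 N, a₂ k₂ * (ellp Y k₂ ^ j * r (α * k₁ * k₂))| ≤ Si * (B * (Real.log Y ^ j * (H₁ + V₁))) := by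
    calc |∑ k₁ ∈ Icc 1 K', a₁ k₁ * ellp Y k₁ ^ i *
          ∑ k₂ ∈ Ioc 0 N, a₂ k₂ * (ellp Y k₂ ^ j * r (α * k₁ * k₂))|
        ≤ ∑ k₁ ∈ Icc 1 K', |a₁ k₁ * ellp Y k₁ ^ i *
          ∑ k₂ ∈ Ioc 0 N, a₂ k₂ * (ellp Y k₂ ^ j * r (α * k₁ * k₂))| := Finset.abs_sum_le_sum_abs _ _
      _ ≤ ∑ k₁ ∈ Icc 1 K', |a₁ k₁| * ellp Y k₁ ^ i * (B * (Real.log Y ^ j * (H₁ + V₁))) := by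
          refine Finset.sum_le_sum fun k₁ hk₁ ↦ ?_
          rw [abs_mul, abs_mul, abs_of_nonneg (hell0 i k₁)]
          exact mul_le_mul_of_nonneg_left (hpart1 k₁ hk₁) (mul_nonneg (abs_nonneg _) (hell0 i k₁))
      _ = (∑ k₁ ∈ Icc 1 K', |a₁ k₁| * ellp Y k₁ ^ i) * (B * (Real.log Y ^ j * (H₁ + V₁))) := by
          rw [Finset.sum_mul]
      _ ≤ Si * (B * (Real.log Y ^ j * (H₁ + V₁))) := mul_le_mul_of_nonneg_right hS' (by positivity)
  have h2 : |∑ k₂ ∈ Icc 1 N, a₂ k₂ * ellp Y k₂ ^ j *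
      ∑ k₁ ∈ Ioc K' N, a₁ k₁ * (ellp Y k₁ ^ i * r (α * k₂ * k₁))| ≤ Sj * ((2 * η) * (Real.log Y ^ i * (G + V))) := by
    calc |∑ k₂ ∈ Icc 1 N, a₂ k₂ * ellp Y k₂ ^ j *
          ∑ k₁ ∈ Ioc K' N, a₁ k₁ * (ellp Y k₁ ^ i * r (α * k₂ * k₁))|
        ≤ ∑ k₂ ∈ Icc 1 N, |a₂ k₂ * ellp Y k₂ ^ j *
          ∑ k₁ ∈ Ioc K' N, a₁ k₁ * (ellp Y k₁ ^ i * r (α * k₂ * k₁))| := Finset.abs_sum_le_sum_abs _ _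
      _ ≤ ∑ k₂ ∈ Icc 1 N, |a₂ k₂| * ellp Y k₂ ^ j * ((2 * η) * (Real.log Y ^ i * (G + V))) := by
          refine Finset.sum_le_sum fun k₂ hk₂ ↦ ?_
          rw [abs_mul, abs_mul, abs_of_nonneg (hell0 j k₂)]
          exact mul_le_mul_of_nonneg_left (hpart2 k₂ hk₂) (mul_nonneg (abs_nonneg _) (hell0 j k₂))
      _ = Sj * ((2 * η) * (Real.log Y ^ i * (G + V))) := by rw [Finset.sum_mul]
  exact (abs_add_le _ _).trans (add_le_add h1 h2)

/-- **Two-variable Abel estimate for a `√`/`log`-controlled weight, two coefficient sequences**: with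
(S1) `|r(y)| ≤ C_s√y`, (S2) `|r(y₁)−r(y₂)| ≤ C_s(y₂−y₁)/√y₁` on `(0,1]`, (T1) `|r(y)| ≤ C_t(1+log y)^N`,
(T2) `|r(y₁)−r(y₂)| ≤ C_t(1+log y₂)^N(y₂−y₁)/y₁` on `[1,∞)`, `Y₁ = 2αK₁Y ≤ 1`, `M = 2αY²`, `P = (1+|log M|)^N`:
`|Σ_{k₁,k₂≤Y} a₁(k₁)a₂(k₂)ℓ⁺(k₁)ⁱℓ⁺(k₂)ʲ r(αk₁k₂)| ≤ Sᵢ(a₁)·B·logʲY·3C_s√Y₁ + Sⱼ(a₂)·2η·logⁱY·(3(C_s + C_tP) + 2C_s + C_tP(1+|log M|))`.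
[cite: KowalskiMichelVanderKam2000, Prop. 5.1 — derivation (corner of the diagonal, general weights, two sequences)] -/
theorem abs_doubleSum_sqrt_log_weight_le₂ {a₁ a₂ : ℕ → ℝ} {r : ℝ → ℝ} {Y α B η Cs Ct : ℝ} {K₁ i j N : ℕ}
    (hY : 1 ≤ Y) (hα : 0 < α) (hi : 1 ≤ i) (hj : 1 ≤ j) (hCs : 0 ≤ Cs) (hCt : 0 ≤ Ct)
    (hB : ∀ e : ℕ, e ≤ ⌊Y⌋₊ → |∑ k ∈ Icc 1 e, a₂ k| ≤ B) (hη : ∀ e : ℕ, K₁ ≤ e → |∑ k ∈ Icc 1 e, a₁ k| ≤ η)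
    (hS1 : ∀ y : ℝ, 0 < y → y ≤ 1 → |r y| ≤ Cs * Real.sqrt y)
    (hS2 : ∀ y₁ y₂ : ℝ, 0 < y₁ → y₁ ≤ y₂ → y₂ ≤ 1 → |r y₁ - r y₂| ≤ Cs * (y₂ - y₁) / Real.sqrt y₁)
    (hT1 : ∀ y : ℝ, 1 ≤ y → |r y| ≤ Ct * (1 + Real.log y) ^ N)
    (hT2 : ∀ y₁ y₂ : ℝ, 1 ≤ y₁ → y₁ ≤ y₂ → |r y₁ - r y₂| ≤ Ct * (1 + Real.log y₂) ^ N * (y₂ - y₁) / y₁)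
    (hY₁ : 2 * α * K₁ * Y ≤ 1) :
    |∑ k₁ ∈ Icc 1 ⌊Y⌋₊, ∑ k₂ ∈ Icc 1 ⌊Y⌋₊,
        a₁ k₁ * a₂ k₂ * ellp Y k₁ ^ i * ellp Y k₂ ^ j * r (α * k₁ * k₂)| ≤
      (∑ k ∈ Icc 1 ⌊Y⌋₊, |a₁ k| * ellp Y k ^ i) *
          (B * (Real.log Y ^ j * (3 * Cs * Real.sqrt (2 * α * K₁ * Y)))) +
        (∑ k ∈ Icc 1 ⌊Y⌋₊, |a₂ k| * ellp Y k ^ j) * ((2 * η) * (Real.log Y ^ i *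
          (3 * (Cs + Ct * (1 + |Real.log (2 * α * Y ^ 2)|) ^ N) + 2 * Cs +
            Ct * (1 + |Real.log (2 * α * Y ^ 2)|) ^ N * (1 + |Real.log (2 * α * Y ^ 2)|)))) := by
  have hY0 : 0 < Y := by linarith
  set Y₁ : ℝ := 2 * α * K₁ * Y with hY₁def
  set M : ℝ := 2 * α * Y ^ 2 with hM
  have hM0 : 0 < M := by positivity
  set P : ℝ := (1 + |Real.log M|) ^ N with hP
  have hP1 : 1 ≤ P := one_le_pow₀ (by linarith [abs_nonneg (Real.log M)])
  set G : ℝ := Cs + Ct * P with hG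
  have hG0 : 0 ≤ G := by positivity
  set K : ℝ := Ct * P with hK
  have hK0 : 0 ≤ K := by positivity
  have hY₁0 : 0 ≤ Y₁ := by positivity
  -- (G): size on `(0, M]`
  have hGbd : ∀ y : ℝ, 0 < y → y ≤ M → |r y| ≤ G := by
    intro y hy hyM
    rcases le_or_gt y 1 with hy1 | hy1
    · have h := hS1 y hy hy1
      have : Real.sqrt y ≤ 1 := Real.sqrt_le_one.2 hy1
      calc |r y| ≤ Cs * Real.sqrt y := h
        _ ≤ Cs * 1 := by gcongr
        _ ≤ G := by rw [hG, mul_one]; linarith [mul_nonneg hCt (zero_le_one.trans hP1)]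
    · have h := hT1 y hy1.le
      have hlog : Real.log y ≤ |Real.log M| := (Real.log_le_log hy hyM).trans (le_abs_self _)
      have hly : 0 ≤ Real.log y := Real.log_nonneg hy1.le
      calc |r y| ≤ Ct * (1 + Real.log y) ^ N := h
        _ ≤ Ct * P := by rw [hP]; gcongr
        _ ≤ G := by rw [hG]; linarith
  -- (T2'): `1/y`-Lipschitz with constant `K` on `[1, M]`
  have hT2' : ∀ y₁ y₂ : ℝ, 1 ≤ y₁ → y₁ ≤ y₂ → y₂ ≤ M → |r y₁ - r y₂| ≤ K * (y₂ - y₁) / y₁ := by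
    intro y₁ y₂ hy₁ h12 hy₂M
    have h := hT2 y₁ y₂ hy₁ h12
    have hy₁0 : 0 < y₁ := one_pos.trans_le hy₁
    have hlog : Real.log y₂ ≤ |Real.log M| := (Real.log_le_log (by linarith) hy₂M).trans (le_abs_self _)
    have hl2 : 0 ≤ Real.log y₂ := Real.log_nonneg (hy₁.trans h12)
    calc |r y₁ - r y₂| ≤ Ct * (1 + Real.log y₂) ^ N * (y₂ - y₁) / y₁ := h
      _ ≤ Ct * P * (y₂ - y₁) / y₁ := by
          rw [hP]; gcongr
  -- the hypotheses of the abstract estimate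
  have hr1 : ∀ y : ℝ, 0 < y → y ≤ 2 * α * K₁ * Y → |r y| ≤ Cs * Real.sqrt Y₁ := by
    intro y hy hyY
    have hy1 : y ≤ 1 := hyY.trans hY₁
    calc |r y| ≤ Cs * Real.sqrt y := hS1 y hy hy1
      _ ≤ Cs * Real.sqrt Y₁ := by gcongr
  have hv1 : ∀ c : ℝ, 0 < c → ∀ w : ℕ, c * ((w : ℝ) + 1) ≤ 2 * α * K₁ * Y →
      ∑ e ∈ Ioc 0 w, |r (c * ((e : ℝ) + 1)) - r (c * e)| ≤ 2 * Cs * Real.sqrt Y₁ := by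
    intro c hc w hcw
    have h := sum_abs_sub_le_of_lipschitz_sqrt (r := r) (C := Cs) hc hS2 (Nat.zero_le w) (hcw.trans hY₁)
    calc _ ≤ 2 * Cs * Real.sqrt (c * ((w : ℝ) + 1)) := h
      _ ≤ 2 * Cs * Real.sqrt Y₁ := by gcongr
  have hrG : ∀ y : ℝ, 0 < y → y ≤ 2 * α * Y ^ 2 → |r y| ≤ G := fun y hy hyM ↦ hGbd y hy hyM
  have hvG : ∀ c : ℝ, 0 < c → ∀ u w : ℕ, u ≤ w → c * ((w : ℝ) + 1) ≤ 2 * α * Y ^ 2 →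
      ∑ e ∈ Ioc u w, |r (c * ((e : ℝ) + 1)) - r (c * e)| ≤ 2 * Cs + 2 * G + K * (1 + |Real.log M|) :=
    fun c hc u w huw hcw ↦ sum_abs_sub_ray_le_log (r := r) hc hK0 hS2 hT2' hGbd huw hcw
  have hmain := abs_doubleSum_bv_pow_le₂ (a₁ := a₁) (a₂ := a₂) (r := r) (K₁ := K₁) hY hα hi hj hB hη
    (by positivity) (by positivity) hr1 hv1 hrG hvG
  -- rewrite the constants
  have hHV : Cs * Real.sqrt Y₁ + 2 * Cs * Real.sqrt Y₁ = 3 * Cs * Real.sqrt (2 * α * K₁ * Y) := by rw [hY₁def]; ring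
  have hGV : G + (2 * Cs + 2 * G + K * (1 + |Real.log M|)) =
      3 * (Cs + Ct * (1 + |Real.log (2 * α * Y ^ 2)|) ^ N) + 2 * Cs +
        Ct * (1 + |Real.log (2 * α * Y ^ 2)|) ^ N * (1 + |Real.log (2 * α * Y ^ 2)|) := by
    simp only [hG, hK, hP, hM]; ring
  rw [hHV, hGV] at hmain
  exact hmain

end Summit.Parity.GeneralizedHardyLittlewood.Theorems.MomentsBeyondDiagonal.DiagCorner

end
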